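import Summits.MatrixMultiplication.OmegaCensus.STPP222PowFromCard
import Summits.MatrixMultiplication.OmegaCensus.STPPTricoloredProduct

/-!
# ω-census, STPP law `(2,2,2)^k`: a POLYNOMIAL uniform threshold — every finite abelian group of order `≥ 2560·k⁶` admits `(2,2,2)^k`

HONEST FRAMING (pub-omega census; verbatim): lottery ticket; floor = certified bounds/negative ranges.
Census STRUCTURE bookkeeping (question Q7 of `STRUCTURE.md`: the uniform threshold `N_k` = least order from which EVERY finite
abelian group admits `k` simultaneous-TPP triples of 2-subsets), not progress on `ω`: a `(2,2,2)^k` family certifies no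
matrix-multiplication bound of interest.

The tree's uniform laws are `N_k ≤ (416k²+416)^k` (`STPP222PowFromCard.lean`) and the quasi-polynomial
`N_k ≤ 26·(832k²)^{⌈log₂ k⌉}` (`STPP222PowFromCardLog.lean`), both by halving `k` recursively over two blocks.  A
tricolored-sum-free (TSF) GRAPH replaces the recursion by a single product and makes the law polynomial:

* `isTricoloredSumFree_graph` — for injective `p : Fin k → K₂`, `q : Fin k → K₃` the triples `((pᵢ,0), (0,qⱼ), (−p_l,−q_l))`
  form a tricolored sum-free set in `K₂ × K₃` (`(pᵢ − p_l, qⱼ − q_l) = 0 ⇔ i = l = j`); so EVERY product of two abelian groups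
  of orders `≥ k` carries a TSF set of size `k` (`exists_isTSF_prod_of_le_card`);
* `exists_isSTPP_222pow_of_card_ge_poly` — **every finite abelian group `G` with `|G| ≥ 10·k²·(8k²+8)²` admits `(2,2,2)^k`.**
  Dichotomy: exponent `≥ 8k(k−1)+8` is the cyclic law `exists_isSTPP_222pow_of_exponent` (`STPP222PowCyclic.lean`); otherwise
  every cyclic factor of `G ≃ Π ℤ/qᵢ` is `≤ 8k²+8 =: E`, and two greedy windows (`exists_subset_prod_window`) split the factors
  into blocks `K₁` (order in `[10, 10E)`), `K₂` (order in `[k, kE)`) and the rest `K₃` (order `≥ |G|/(10kE²) ≥ k`); `K₁`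
  carries one triple (`exists_isSTPP_222one_of_card`, Pb49: `N₁ = 10`), `K₂ × K₃` carries the TSF graph of size `k`, and the
  TSF product law NR142 (`exists_isSTPP_222pow_mul_of_tsf`, `STPPTricoloredProduct.lean`) gives `(2,2,2)^{1·k} ⊆ K₁ × (K₂ × K₃)
  ↪ G`;
* `exists_isSTPP_222pow_of_card_ge_pow_six` — the monomial envelope **`N_k ≤ 2560·k⁶`** (`10k²(8k²+8)² ≤ 2560k⁶` for `k ≥ 1`).

Numerically `10k²(8k²+8)²` is `2 959 360, 10 816 000, 173 056 000, 1.08·10¹⁰` for `k = 4, 5, 8, 16`, against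
`(416k²+416)^k ≈ 2.5·10¹⁵, 1.5·10²⁰, 2.9·10³⁵, 2.9·10⁸⁰`.  Still far from the census
values (`N₄ ≤ 66`, kernel), no sharpness claimed; with the base-3 cyclic law of `STPP222PowCyclicThreeAPFree.lean` in place of the
quadratic one the same argument gives `O(k²·9^{⌈log₂k⌉}) = O(k^{5.17})` (not carried out here).

References: H. Cohn, R. Kleinberg, B. Szegedy, C. Umans, FOCS 2005 (arXiv:math/0511460), Def. 5.1; J. Blasiak et al., Discrete
Analysis 2017:3, Def. 3.1 (tricolored sum-free sets).  Seat pub-omega-stpp-3 (gen 10), 2026-08-24.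
-/

open Literature.Computability.AlgebraicComplexity Literature.Combinatorics.Additive Finset

namespace Summit.MatrixMultiplication.OmegaCensus

/-! ## 1. The tricolored-sum-free graph -/

/-- **TSF graph.** For injective `p : Fin k → K₂` and `q : Fin k → K₃`, the triples `σᵢ = (pᵢ, 0)`, `τⱼ = (0, qⱼ)`,
`υ_l = (−p_l, −q_l)` of `K₂ × K₃` satisfy `σᵢ + τⱼ + υ_l = 0 ⇔ i = j = l`.
[cite: BlasiakChurchCohnGrochowNaslundSawinUmans2017, Def. 3.1] -/
theorem isTricoloredSumFree_graph {K₂ K₃ : Type*} [AddCommGroup K₂] [AddCommGroup K₃] {k : ℕ}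
    {p : Fin k → K₂} {q : Fin k → K₃} (hp : Function.Injective p) (hq : Function.Injective q) :
    IsTricoloredSumFree (fun i => ((p i, 0) : K₂ × K₃)) (fun i => ((0, q i) : K₂ × K₃))
      (fun i => ((-p i, -q i) : K₂ × K₃)) := by
  intro i j l
  constructor
  · intro h
    simp only [Prod.mk_add_mk, add_zero, zero_add, Prod.mk_eq_zero, ← sub_eq_add_neg, sub_eq_zero] at h
    obtain ⟨h1, h2⟩ := h
    have hil : i = l := hp h1
    have hjl : j = l := hq h2
    exact ⟨hil.trans hjl.symm, hjl⟩
  · rintro ⟨rfl, rfl⟩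
    simp

/-- **Every product `K₂ × K₃` of finite abelian groups of orders `≥ k` carries a tricolored sum-free set of size `k`**
(the TSF graph on injections `Fin k ↪ K₂`, `Fin k ↪ K₃`). [cite: BlasiakChurchCohnGrochowNaslundSawinUmans2017, Def. 3.1] -/
theorem exists_isTSF_prod_of_le_card {K₂ K₃ : Type*} [AddCommGroup K₂] [AddCommGroup K₃] [Finite K₂] [Finite K₃]
    {k : ℕ} (h₂ : k ≤ Nat.card K₂) (h₃ : k ≤ Nat.card K₃) :
    ∃ σ τ υ : Fin k → K₂ × K₃, IsTricoloredSumFree σ τ υ := by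
  haveI := Fintype.ofFinite K₂
  haveI := Fintype.ofFinite K₃
  have hp : Nonempty (Fin k ↪ K₂) :=
    Function.Embedding.nonempty_iff_card_le.2 (by rw [Fintype.card_fin, ← Nat.card_eq_fintype_card]; exact h₂)
  have hq : Nonempty (Fin k ↪ K₃) :=
    Function.Embedding.nonempty_iff_card_le.2 (by rw [Fintype.card_fin, ← Nat.card_eq_fintype_card]; exact h₃)
  obtain ⟨p⟩ := hp
  obtain ⟨q⟩ := hq
  exact ⟨_, _, _, isTricoloredSumFree_graph p.injective q.injective⟩

/-! ## 2. The polynomial uniform law -/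

/-- **Every finite abelian group of order `≥ 10·k²·(8k²+8)²` admits `k` simultaneous-TPP triples of 2-subsets** (the census
pattern `(2,2,2)^k`; STRUCTURE Q7: `N_k ≤ 10k²(8k²+8)²`, polynomial in `k`).  Exponent `≥ 8k(k−1)+8`: the cyclic law.
Otherwise three greedy blocks of `Π ℤ/qᵢ` (orders `≥ 10`, `≥ k`, `≥ k`), one triple in the first, the TSF graph of size `k` in
the product of the other two, the TSF product law, transport.  No sharpness claimed.
[cite: CohnKleinbergSzegedyUmans2005, Def. 5.1] -/
theorem exists_isSTPP_222pow_of_card_ge_poly (k : ℕ) {G : Type*} [AddCommGroup G] [Finite G]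
    (hG : 10 * k ^ 2 * (8 * k ^ 2 + 8) ^ 2 ≤ Nat.card G) :
    ∃ A B C : Fin k → Finset G, IsSTPP A B C ∧ ∀ i, (A i).card = 2 ∧ (B i).card = 2 ∧ (C i).card = 2 := by
  classical
  rcases Nat.eq_zero_or_pos k with hk0 | hk1
  · subst hk0
    exact ⟨fun _ => ∅, fun _ => ∅, fun _ => ∅, fun i => i.elim0, fun i => i.elim0⟩
  by_cases hexp : 8 * k * (k - 1) + 8 ≤ AddMonoid.exponent G
  · exact exists_isSTPP_222pow_of_exponent k hexp
  push Not at hexp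
  -- the factor bound `E`
  set E : ℕ := 8 * k ^ 2 + 8 with hEdef
  have hE2 : 2 ≤ E := by omega
  obtain ⟨ι, _, q, hq0, hdvd, hcard, ⟨f⟩⟩ := exists_addEquiv_pi_zmod G
  haveI : ∀ i, NeZero (q i) := fun i => ⟨(hq0 i).ne'⟩
  have hexppos : 0 < AddMonoid.exponent G := Nat.pos_of_ne_zero AddMonoid.exponent_ne_zero_of_finite
  have hq1 : ∀ i, 1 ≤ q i := hq0
  have hqE : ∀ i, q i ≤ E := fun i => by
    have h1 := Nat.le_of_dvd hexppos (hdvd i)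
    have h2 := cyclicThreshold_le_sq k
    omega
  -- numeric consequences of `hG`
  have hk2 : k ≤ k ^ 2 := by nlinarith
  have hN : 10 * k ^ 2 * E ^ 2 ≤ ∏ i, q i := by rw [hcard]; exact hG
  have h10 : 10 ≤ ∏ i, q i := le_trans (by nlinarith) hN
  -- block 1: order in `[10, 10E)`
  obtain ⟨t₁, -, ht1a, ht1b⟩ :=
    exists_subset_prod_window q (T := 10) (M := E) (by norm_num) hE2 hq1 hqE univ h10
  -- its complement `R = Π_{i ∉ t₁} ℤ/qᵢ` has order `P₁ ≥ k²E`
  have hsplit1 : (∏ i ∈ t₁, q i) * ∏ i ∈ t₁ᶜ, q i = ∏ i, q i := Finset.prod_mul_prod_compl t₁ q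
  have hP1 : k ^ 2 * E ≤ ∏ i ∈ t₁ᶜ, q i := by
    by_contra hlt
    push Not at hlt
    have hpos : 0 < ∏ i ∈ t₁, q i := by omega
    have h1 : (∏ i ∈ t₁, q i) * ∏ i ∈ t₁ᶜ, q i < (∏ i ∈ t₁, q i) * (k ^ 2 * E) :=
      (Nat.mul_lt_mul_left hpos).2 hlt
    have h2 : (∏ i ∈ t₁, q i) * (k ^ 2 * E) ≤ 10 * E * (k ^ 2 * E) := Nat.mul_le_mul_right _ ht1b.le
    rw [hsplit1] at h1
    nlinarith
  -- re-index the complement by the subtype `ι₁ = {i // i ∉ t₁}`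
  let q₁ : {i // i ∉ t₁} → ℕ := fun j => q j.1
  have hprod1 : ∏ j, q₁ j = ∏ i ∈ t₁ᶜ, q i :=
    (Finset.prod_subtype t₁ᶜ (fun x => by rw [Finset.mem_compl]) q).symm
  -- block 2 inside the complement: order in `[k, kE)`
  obtain ⟨t₂, -, ht2a, ht2b⟩ :=
    exists_subset_prod_window q₁ (T := k) (M := E) hk1 hE2 (fun j => hq1 j.1) (fun j => hqE j.1) univ
      (by rw [hprod1]; exact le_trans (le_trans hk2 (Nat.le_mul_of_pos_right _ (by omega))) hP1)
  -- block 3 = the rest of the complement: order `≥ k`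
  have hsplit2 : (∏ j ∈ t₂, q₁ j) * ∏ j ∈ t₂ᶜ, q₁ j = ∏ j, q₁ j := Finset.prod_mul_prod_compl t₂ q₁
  have hP3 : k ≤ ∏ j ∈ t₂ᶜ, q₁ j := by
    by_contra hlt
    push Not at hlt
    have hpos : 0 < ∏ j ∈ t₂, q₁ j := by omega
    have h1 : (∏ j ∈ t₂, q₁ j) * ∏ j ∈ t₂ᶜ, q₁ j < (∏ j ∈ t₂, q₁ j) * k := (Nat.mul_lt_mul_left hpos).2 hlt
    have h2 : (∏ j ∈ t₂, q₁ j) * k ≤ k * E * k := Nat.mul_le_mul_right _ ht2b.le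
    rw [hsplit2, hprod1] at h1
    nlinarith
  -- the three blocks as groups
  have hK1 : ∃ A B C : Fin 1 → Finset (Π i : {i // i ∈ t₁}, ZMod (q i)), IsSTPP A B C ∧
      ∀ i, (A i).card = 2 ∧ (B i).card = 2 ∧ (C i).card = 2 :=
    exists_isSTPP_222one_of_card (by rw [natCard_pi_zmod_mem]; exact ht1a)
  obtain ⟨σ, τ, υ, hT⟩ := exists_isTSF_prod_of_le_card
    (K₂ := Π j : {j : {i // i ∉ t₁} // j ∈ t₂}, ZMod (q₁ j)) (K₃ := Π j : {j : {i // i ∉ t₁} // j ∉ t₂}, ZMod (q₁ j))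
    (k := k) (by rw [natCard_pi_zmod_mem]; exact ht2a) (by rw [natCard_pi_zmod_not_mem]; exact hP3)
  have h12 := exists_isSTPP_222pow_mul_of_tsf hK1 hT
  rw [one_mul] at h12
  -- glue the blocks back: `K₂ × K₃ ↪ R`, `K₁ × R ↪ Π ℤ/qᵢ ≃ G`
  obtain ⟨φ₂, hφ₂⟩ := exists_prodPi_injective (fun j : {i // i ∉ t₁} => ZMod (q₁ j)) t₂
  obtain ⟨φ₁, hφ₁⟩ := exists_prodPi_injective (fun i => ZMod (q i)) t₁
  have h3 := exists_isSTPP_222pow_of_injective ((AddMonoidHom.id _).prodMap φ₂)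
    (Function.injective_id.prodMap hφ₂) h12
  have h4 := exists_isSTPP_222pow_of_injective φ₁ hφ₁ h3
  exact exists_isSTPP_222pow_of_injective f.symm.toAddMonoidHom f.symm.injective h4

/-- **`N_k ≤ 2560·k⁶`** — the monomial envelope of `exists_isSTPP_222pow_of_card_ge_poly` (`10k²(8k²+8)² ≤ 2560k⁶` for `k ≥ 1`;
`k = 0` is the empty family): every finite abelian group of order `≥ 2560·k⁶` admits `(2,2,2)^k`.  No sharpness claimed.
[cite: CohnKleinbergSzegedyUmans2005, Def. 5.1] -/
theorem exists_isSTPP_222pow_of_card_ge_pow_six (k : ℕ) {G : Type*} [AddCommGroup G] [Finite G]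
    (hG : 2560 * k ^ 6 ≤ Nat.card G) :
    ∃ A B C : Fin k → Finset G, IsSTPP A B C ∧ ∀ i, (A i).card = 2 ∧ (B i).card = 2 ∧ (C i).card = 2 := by
  rcases Nat.eq_zero_or_pos k with hk0 | hk1
  · subst hk0
    exact ⟨fun _ => ∅, fun _ => ∅, fun _ => ∅, fun i => i.elim0, fun i => i.elim0⟩
  refine exists_isSTPP_222pow_of_card_ge_poly k (le_trans ?_ hG)
  have hk : 1 ≤ k := hk1
  have h1 : 8 * k ^ 2 + 8 ≤ 16 * k ^ 2 := by nlinarith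
  calc 10 * k ^ 2 * (8 * k ^ 2 + 8) ^ 2 ≤ 10 * k ^ 2 * (16 * k ^ 2) ^ 2 :=
        Nat.mul_le_mul_left _ (Nat.pow_le_pow_left h1 2)
    _ = 2560 * k ^ 6 := by ring

/-! ## 3. APPEND (gen 10, same seat): the master form — any exponent law `E` gives the uniform law `10·k²·E²`

The three-block argument above uses the cyclic law only through "exponent `≥ E` ⇒ `(2,2,2)^k`" with `E = 8k²+8`.  Stated for an
ARBITRARY exponent threshold `E` (a hypothesis about the group at hand), it reads: **if `G` admits `(2,2,2)^k` as soon as its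
exponent is `≥ E`, and `|G| ≥ 10·k²·E²`, then `G` admits `(2,2,2)^k`.**  Plugging the base-3 law of
`STPP222PowCyclicThreeAPFree.lean` (`E = 8·3^t` for `k ≤ 2^t`) gives `N_k ≤ 640·k²·9^{⌈log₂k⌉} = O(k^{5.17})`; plugging a future
`E = O(k^{1+ε})` law would give `N_k = O(k^{4+2ε})`.  (The corollary files live next to the respective exponent laws.) -/

/-- **Master form of the polynomial uniform law.** For a finite abelian group `G` and naturals `k, E`: if `E ≤ exponent G`
implies that `G` admits `(2,2,2)^k`, and `|G| ≥ 10·k²·E²`, then `G` admits `(2,2,2)^k`.  (Exponent `< E`: every cyclic factor of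
`G ≃ Π ℤ/qᵢ` is `< E`; greedy blocks of orders `≥ 10`, `≥ k`, `≥ k`; one triple × the TSF graph; transport.)
[cite: CohnKleinbergSzegedyUmans2005, Def. 5.1] -/
theorem exists_isSTPP_222pow_of_card_ge_of_exponent_law (k E : ℕ) {G : Type*} [AddCommGroup G] [Finite G]
    (hlaw : E ≤ AddMonoid.exponent G →
      ∃ A B C : Fin k → Finset G, IsSTPP A B C ∧ ∀ i, (A i).card = 2 ∧ (B i).card = 2 ∧ (C i).card = 2)
    (hG : 10 * k ^ 2 * E ^ 2 ≤ Nat.card G) :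
    ∃ A B C : Fin k → Finset G, IsSTPP A B C ∧ ∀ i, (A i).card = 2 ∧ (B i).card = 2 ∧ (C i).card = 2 := by
  classical
  rcases Nat.eq_zero_or_pos k with hk0 | hk1
  · subst hk0
    exact ⟨fun _ => ∅, fun _ => ∅, fun _ => ∅, fun i => i.elim0, fun i => i.elim0⟩
  by_cases hexp : E ≤ AddMonoid.exponent G
  · exact hlaw hexp
  push Not at hexp
  obtain ⟨ι, _, q, hq0, hdvd, hcard, ⟨f⟩⟩ := exists_addEquiv_pi_zmod G
  haveI : ∀ i, NeZero (q i) := fun i => ⟨(hq0 i).ne'⟩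
  have hexppos : 0 < AddMonoid.exponent G := Nat.pos_of_ne_zero AddMonoid.exponent_ne_zero_of_finite
  have hE2 : 2 ≤ E := by omega
  have hq1 : ∀ i, 1 ≤ q i := hq0
  have hqE : ∀ i, q i ≤ E := fun i => by
    have h1 := Nat.le_of_dvd hexppos (hdvd i)
    omega
  have hk2 : k ≤ k ^ 2 := by nlinarith
  have hN : 10 * k ^ 2 * E ^ 2 ≤ ∏ i, q i := by rw [hcard]; exact hG
  have h10 : 10 ≤ ∏ i, q i := le_trans (by nlinarith) hN
  obtain ⟨t₁, -, ht1a, ht1b⟩ :=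
    exists_subset_prod_window q (T := 10) (M := E) (by norm_num) hE2 hq1 hqE univ h10
  have hsplit1 : (∏ i ∈ t₁, q i) * ∏ i ∈ t₁ᶜ, q i = ∏ i, q i := Finset.prod_mul_prod_compl t₁ q
  have hP1 : k ^ 2 * E ≤ ∏ i ∈ t₁ᶜ, q i := by
    by_contra hlt
    push Not at hlt
    have hpos : 0 < ∏ i ∈ t₁, q i := by omega
    have h1 : (∏ i ∈ t₁, q i) * ∏ i ∈ t₁ᶜ, q i < (∏ i ∈ t₁, q i) * (k ^ 2 * E) :=
      (Nat.mul_lt_mul_left hpos).2 hlt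
    have h2 : (∏ i ∈ t₁, q i) * (k ^ 2 * E) ≤ 10 * E * (k ^ 2 * E) := Nat.mul_le_mul_right _ ht1b.le
    rw [hsplit1] at h1
    nlinarith
  let q₁ : {i // i ∉ t₁} → ℕ := fun j => q j.1
  have hprod1 : ∏ j, q₁ j = ∏ i ∈ t₁ᶜ, q i :=
    (Finset.prod_subtype t₁ᶜ (fun x => by rw [Finset.mem_compl]) q).symm
  obtain ⟨t₂, -, ht2a, ht2b⟩ :=
    exists_subset_prod_window q₁ (T := k) (M := E) hk1 hE2 (fun j => hq1 j.1) (fun j => hqE j.1) univ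
      (by rw [hprod1]; exact le_trans (le_trans hk2 (Nat.le_mul_of_pos_right _ (by omega))) hP1)
  have hsplit2 : (∏ j ∈ t₂, q₁ j) * ∏ j ∈ t₂ᶜ, q₁ j = ∏ j, q₁ j := Finset.prod_mul_prod_compl t₂ q₁
  have hP3 : k ≤ ∏ j ∈ t₂ᶜ, q₁ j := by
    by_contra hlt
    push Not at hlt
    have hpos : 0 < ∏ j ∈ t₂, q₁ j := by omega
    have h1 : (∏ j ∈ t₂, q₁ j) * ∏ j ∈ t₂ᶜ, q₁ j < (∏ j ∈ t₂, q₁ j) * k := (Nat.mul_lt_mul_left hpos).2 hlt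
    have h2 : (∏ j ∈ t₂, q₁ j) * k ≤ k * E * k := Nat.mul_le_mul_right _ ht2b.le
    rw [hsplit2, hprod1] at h1
    nlinarith
  have hK1 : ∃ A B C : Fin 1 → Finset (Π i : {i // i ∈ t₁}, ZMod (q i)), IsSTPP A B C ∧
      ∀ i, (A i).card = 2 ∧ (B i).card = 2 ∧ (C i).card = 2 :=
    exists_isSTPP_222one_of_card (by rw [natCard_pi_zmod_mem]; exact ht1a)
  obtain ⟨σ, τ, υ, hT⟩ := exists_isTSF_prod_of_le_card
    (K₂ := Π j : {j : {i // i ∉ t₁} // j ∈ t₂}, ZMod (q₁ j)) (K₃ := Π j : {j : {i // i ∉ t₁} // j ∉ t₂}, ZMod (q₁ j))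
    (k := k) (by rw [natCard_pi_zmod_mem]; exact ht2a) (by rw [natCard_pi_zmod_not_mem]; exact hP3)
  have h12 := exists_isSTPP_222pow_mul_of_tsf hK1 hT
  rw [one_mul] at h12
  obtain ⟨φ₂, hφ₂⟩ := exists_prodPi_injective (fun j : {i // i ∉ t₁} => ZMod (q₁ j)) t₂
  obtain ⟨φ₁, hφ₁⟩ := exists_prodPi_injective (fun i => ZMod (q i)) t₁
  have h3 := exists_isSTPP_222pow_of_injective ((AddMonoidHom.id _).prodMap φ₂)
    (Function.injective_id.prodMap hφ₂) h12
  have h4 := exists_isSTPP_222pow_of_injective φ₁ hφ₁ h3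
  exact exists_isSTPP_222pow_of_injective f.symm.toAddMonoidHom f.symm.injective h4

/-- The quadratic instance recovered from the master form (sanity check of the refactoring; the same statement as
`exists_isSTPP_222pow_of_card_ge_poly` with the bound written `10·k²·(8k(k−1)+8)²`). [cite: CohnKleinbergSzegedyUmans2005, Def. 5.1] -/
theorem exists_isSTPP_222pow_of_card_ge_poly' (k : ℕ) {G : Type*} [AddCommGroup G] [Finite G]
    (hG : 10 * k ^ 2 * (8 * k * (k - 1) + 8) ^ 2 ≤ Nat.card G) :
    ∃ A B C : Fin k → Finset G, IsSTPP A B C ∧ ∀ i, (A i).card = 2 ∧ (B i).card = 2 ∧ (C i).card = 2 :=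
  exists_isSTPP_222pow_of_card_ge_of_exponent_law k (8 * k * (k - 1) + 8)
    (fun h => exists_isSTPP_222pow_of_exponent k h) hG

/-! ## 4. APPEND 2 (gen 10, same seat): TSF-graph hosts — the quadratic UPPER law inside a bounded-exponent class

The TSF graph needs no cyclic factor at all: one `(2,2,2)` triple in `K₁` and two blocks `K₂`, `K₃` of orders `≥ k` give
`(2,2,2)^k ⊆ K₁ × (K₂ × K₃)`.  Inside the class of exponent-`p` groups this is a QUADRATIC upper law — e.g. exponent `2`:
`(2,2,2)^k ⊆ (ℤ/2)³ × (ℤ/2)^t × (ℤ/2)^t` for `k ≤ 2^t`, a host of order `8·4^t < 32k²` — to be read against the effective LOWER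
law `k ≤ 3·|G|^{1−c_p}` of `STPPElementaryLowerLaw.lean` (`|G| ≥ (k/3)^{1.089}` at `p = 2`): in a fixed exponent the threshold
of `(2,2,2)^k` is polynomial in `k` with exponent between `1.089` and `2` (`p = 2`).  No sharpness claimed. -/

/-- **TSF-graph hosts.** If `K₁` carries one simultaneous-TPP triple of 2-subsets and `K₂`, `K₃` are finite abelian groups of
orders `≥ k`, then `K₁ × (K₂ × K₃)` carries `(2,2,2)^k` (TSF graph of size `k` in `K₂ × K₃`, product law NR142).
[cite: CohnKleinbergSzegedyUmans2005, Def. 5.1] -/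
theorem exists_isSTPP_222pow_prod_of_le_card {K₁ K₂ K₃ : Type*} [AddCommGroup K₁] [AddCommGroup K₂] [AddCommGroup K₃]
    [Finite K₂] [Finite K₃] {k : ℕ}
    (h₁ : ∃ A B C : Fin 1 → Finset K₁, IsSTPP A B C ∧ ∀ i, (A i).card = 2 ∧ (B i).card = 2 ∧ (C i).card = 2)
    (h₂ : k ≤ Nat.card K₂) (h₃ : k ≤ Nat.card K₃) :
    ∃ A B C : Fin k → Finset (K₁ × (K₂ × K₃)), IsSTPP A B C ∧
      ∀ i, (A i).card = 2 ∧ (B i).card = 2 ∧ (C i).card = 2 := by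
  obtain ⟨σ, τ, υ, hT⟩ := exists_isTSF_prod_of_le_card h₂ h₃
  have h := exists_isSTPP_222pow_mul_of_tsf h₁ hT
  rwa [one_mul] at h

/-- **Any block of order `≥ 10` times two blocks of orders `≥ k` hosts `(2,2,2)^k`** (Pb49 seed `N₁ = 10` in the first block).
[cite: CohnKleinbergSzegedyUmans2005, Def. 5.1] -/
theorem exists_isSTPP_222pow_prod_of_card_ge_ten {K₁ K₂ K₃ : Type*} [AddCommGroup K₁] [AddCommGroup K₂] [AddCommGroup K₃]
    [Finite K₁] [Finite K₂] [Finite K₃] {k : ℕ} (h₁ : 10 ≤ Nat.card K₁) (h₂ : k ≤ Nat.card K₂) (h₃ : k ≤ Nat.card K₃) :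
    ∃ A B C : Fin k → Finset (K₁ × (K₂ × K₃)), IsSTPP A B C ∧
      ∀ i, (A i).card = 2 ∧ (B i).card = 2 ∧ (C i).card = 2 :=
  exists_isSTPP_222pow_prod_of_le_card (exists_isSTPP_222one_of_card h₁) h₂ h₃

/-- **Exponent 2: `(2,2,2)^k ⊆ (ℤ/2)³ × (ℤ/2)^t × (ℤ/2)^t` for every `k ≤ 2^t`** — an elementary abelian 2-group of order
`8·4^t` (`< 32k²` for the least such `t`); seed `(2,2,2)¹ ⊆ (ℤ/2)³` (`exists_isSTPP_222pow1_seed_2_2_2`).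
[cite: CohnKleinbergSzegedyUmans2005, Def. 5.1] -/
theorem exists_isSTPP_222pow_elementary_two (t k : ℕ) (hk : k ≤ 2 ^ t) :
    ∃ A B C : Fin k → Finset ((ZMod 2 × ZMod 2 × ZMod 2) × ((Fin t → ZMod 2) × (Fin t → ZMod 2))), IsSTPP A B C ∧
      ∀ i, (A i).card = 2 ∧ (B i).card = 2 ∧ (C i).card = 2 := by
  have hc : Nat.card (Fin t → ZMod 2) = 2 ^ t := by
    rw [Nat.card_pi]; simp [Finset.prod_const]
  exact exists_isSTPP_222pow_prod_of_le_card exists_isSTPP_222pow1_seed_2_2_2 (by rw [hc]; exact hk) (by rw [hc]; exact hk)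

/-- **Exponent `p` (any `n ≥ 3`, e.g. `n` prime): `(2,2,2)^k ⊆ (ℤ/n)³ × (ℤ/n)^t × (ℤ/n)^t` for every `k ≤ n^t`** — order
`n^{3+2t}`; seed: `(ℤ/n)³` has order `≥ 27 ≥ 10`. [cite: CohnKleinbergSzegedyUmans2005, Def. 5.1] -/
theorem exists_isSTPP_222pow_exponent_pow (n t k : ℕ) (hn : 3 ≤ n) (hk : k ≤ n ^ t) :
    ∃ A B C : Fin k → Finset ((Fin 3 → ZMod n) × ((Fin t → ZMod n) × (Fin t → ZMod n))), IsSTPP A B C ∧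
      ∀ i, (A i).card = 2 ∧ (B i).card = 2 ∧ (C i).card = 2 := by
  haveI : NeZero n := ⟨by omega⟩
  have hc : ∀ s : ℕ, Nat.card (Fin s → ZMod n) = n ^ s := fun s => by
    rw [Nat.card_pi]; simp [Finset.prod_const]
  refine exists_isSTPP_222pow_prod_of_card_ge_ten ?_ (by rw [hc]; exact hk) (by rw [hc]; exact hk)
  rw [hc]
  calc 10 ≤ 3 ^ 3 := by norm_num
    _ ≤ n ^ 3 := Nat.pow_le_pow_left hn 3

end Summit.MatrixMultiplication.OmegaCensus
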